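import Mathlib.Tactic

/-!
# Stub-ideation k1 · g45 — «weaken / strengthen» on HARDEST (a) of `stub_heegnerIndexLowerAtTwo`
# The HEIGHT-EXTENDED digit model: what RT⁺ and road B⁻ consume of (2)₂ / (3)₂ / (5)₂ = PRGZ₂,
# the ONE merged one-sided inequality, its weight, and the bilinear weight-1 pair NO-GO.

Crux `SplitBadTwoLowerHalfOfFacts` (stmt-BirchSwinnertonDyer-27851), stub `stub_heegnerIndexLowerAtTwo`
(skeleton of record `f2bd84c029a8a938`, line `heegner_index_two`). STUB-PLAN v8.2 fixes HARDEST (a) =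
the weight-2 Heegner bridge `v ≥ 2·v₂ log_ω(y_K) + κ(key)` (R226) with producers {engine BDP₂⁻, RT⁺ =
(2)₂ ∧ (3)₂ ∧ (5)₂ PRGZ₂ ∧ colinearity ∧ P-Bert}; FALLBACK 1″ = road B⁻ = (PRGZ₂) ∧ (GZ) ∧ (MC⁻) ∧ (ALG⁻).

This file is the `k = 1` («weakest sufficient form / strongest provable form») certificate. It EXTENDS
k3-g45's index-currency model (`HeegnerShiftK3G45.DigitModel`: no height coordinates) by the 2-adic
HEIGHT coordinates through which both producer roads of record pass, and proves, by linear arithmetic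
over `ℤ` only:

* §2 `xLawK_iff_totalDefect` — RT⁺ consumes its three laws (2)₂, (3)₂, (5)₂ ONLY through the SUM of
  their defects: with defects `δ₂ δ₃ δ₅` the `x`-law with constant `κ` holds iff `κ ≤ c₁ + d₃ + d₅ + δ₂ +
  δ₃ + δ₅`; the twin's `Ш_an`, the twin digit and `v₂⟨P,P⟩₂` CANCEL (the last is K21's «index and height
  cancelling», re-proved here only as the carrier of the new statements; P-Bert enters as finiteness of
  `hP`, i.e. well-formedness of `lam = hc − hP`, never as a valuation bound).
* §3 `Merged` — the ONE one-sided GZ-sensitive inequality RT⁺ needs: in intrinsic coordinates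
  `v₂⟨y_K,y_K⟩₂ + v₂ log_ω(y_K) + e ≤ v₂⟨c_ell, y_K⟩₂ + v₂ val_tw` («`⟨y_K,y_K⟩₂·log_ω y_K·2^e` divides
  `⟨c_ell,y_K⟩₂ · 𝓛₂(ψ*_tw)`»); `merged_iff_xLawK`: given (2)₂ (any defect) it is EQUIVALENT to the
  `x`-law — the weakest sufficient AND necessary GZ-sensitive input of RT⁺; `merged_of_lb`: it follows
  from the one-sided halves (3)₂⁻ ⊕ (5)₂⁻, never from their exactness.
* §4 `prgzlb_iff_merged`, `lower_of_roadB_oneSided`, `prgzlb_iff_lower_of_twoSided` — road B⁻ consumes PRGZ₂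
  through the SAME one-sided clause `PRGZlb` («`⟨y_K,y_K⟩₂` divides `𝓛'_cyc(ψ_W)·val_tw·2^e`»), which is
  `Merged` rewritten by the weight-0 identity (3)₂: ONE GZ-sensitive research node (the H-ρ cut, R174″ ∥
  R175, read ONE-SIDEDLY) serves TOP's producer and FALLBACK 1″ at once; and modulo MC⁼ + exact ALG the
  clause is ≡ LOWER (R226-consistency: it is weight 2, see §6).
* §4b `xDefect_eq_shaDefect` — modulo the two-sided weight-0 identities ONE integer remains:
  `v + vt − 2x − digits = B − A`; so LOWER ≡ the `x`-law (R226 re-derived through heights) and the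
  strongest PROVABLE-type form is the REVERSE `x`-law ≡ UPPER (`xLawKrev_iff_upper_twoSided`).
* §5 `no_uniform_bilinear_pair`, `bilinearPair_iff_window` — the canonical weight-1 ⊕ weight-1 split of
  `Merged` along the bilinear form, `W1` («`c_ell ∈ 2^{e}ℤ₂·y_K` in `H¹_f`: ES class integrally on the
  Heegner line») ⊕ `W2` («`val_tw` divisible by `log_ω(y_K)·2^{e}`»), implies `Merged` but holds EXACTLY
  on the window `|A_tw − A_W − 2ℓ| ≤ O(1)` of twin-balanced members: for every `e` there are members
  consistent with every identity, with GZ, UPPER, LOWER and the `x`-law where `W1` fails, and members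
  where `W2` fails. B80's parked «weight-1 half-bridge» therefore has NO bilinear realisation; §5b
  `xLawK_iff_sqrt`: the only uniform weight-1 realisation is a SELF-partnered square root `2w = v + vt +
  r` with `w ≥ x + e` — the toric-period / BDP currency of T3.7-LT (`Ka·Kb = w·S²`), i.e. the engine road.
* §6 weights (R226's test, executable): `Merged`/`PRGZlb`/`XLawK`/`Lower` shift by `2t`, `W1`/`W2` by
  `t`, the identities (2)₂/(3)₂/`LamDef`/`TwinVal`/`MCcyc`/`ALGub` by `0` under the Heegner shift
  `i ↦ i + t` (with `A ↦ A + 2t`, GZ-preserving).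

Nothing here is a theorem about elliptic curves: it is the valuation SHADOW of the plan's laws, one
member at a time, with every printed / conjectural input an explicit hypothesis. BSD is NOT proved; the
crux and the stub are NOT proved; no producer of (a) is claimed.

Pointers: R226 / B80 / K64 (`HeegnerShiftK3G45.*`, crux file `STUB_IDEAS_…_3_g45.lean`); K21 (rows 47 /
62: Rubin's triangle, index and height cancelling); §3 (iii)(b) (one-sided ALG); row 61 (PRGZ₂ print-claim,
Disegni 2017 Thm B); row 66 / R154 (P-Bert executed: tree
`bertrand_pairingSq_self_ne_zero_two_of_j_eq_neg3375`); T3.7-LT / T3.7-Q (square-root currency).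
Darmon (in Cornell–Silverman–Stevens 1997) p. 655: Rubin's out-of-range formula "uses the theory of
elliptic units, as well as the formula of Gross–Zagier and Perrin-Riou's p-adic analogue, in an essential
way" — the print form of §4's «same clause».
-/

set_option linter.dupNamespace false

namespace Summit.BirchSwinnertonDyer.BirchSwinnertonDyer.Cruxes.SplitBadTwoLowerHalfOfFacts.WeakStrongK1G45

/-- One member `W` (rank one, CM by `ℚ(√−7)`, additive at the split prime `2`) of a dyadic key class,
with its designer Heegner frame `(K, y_K)`, generator `P` of `W(ℚ)/tors` (`y_K ≐ 2^i·P`), elliptic-unit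
Euler-system class `c_ell = λ·P ∈ Sel(ℚ, T₂W) ⊗ ℚ₂` (colinearity = Selmer rank one, GZK), and the
rank-zero twin `W^{D_K}` inside `L(W/K,s)`. Every field is a 2-adic valuation (an integer). -/
structure HModel where
  /-- `v₂` of the Heegner index relative to the generator (`y_K ≐ 2^i · P`). GZ-sensitive. -/
  i : ℤ
  /-- `v₂ #Ш(W/ℚ)[2^∞]`. -/
  B : ℤ
  /-- `v₂ Ш_an(W)` (rank one, Gross–Zagier normalisation). -/
  A : ℤ
  /-- `v₂ Ш_an(W^{D_K})` — the twin (rank zero). -/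
  At : ℤ
  /-- `v₂` of the OUT-OF-RANGE Katz value of `W` at `ψ*_W` (S2′'s value, de Shalit II.4.16 avatar). -/
  v : ℤ
  /-- `v₂` of the IN-RANGE Katz value of the twin. -/
  vt : ℤ
  /-- `v₂ λ`, where `c_ell = λ · P` in `Sel ⊗ ℚ₂`. -/
  lam : ℤ
  /-- `v₂ ⟨c_ell, P⟩₂` (cyclotomic 2-adic height pairing). -/
  hc : ℤ
  /-- `v₂ 𝓛'_cyc(ψ_W)` — cyclotomic derivative of `W`'s branch at `𝟙`. -/
  L1 : ℤ
  /-- `v₂ f'(0)` — leading term of the cyclotomic characteristic series of the dual Selmer (road B⁻). -/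
  fp : ℤ
  /-- `v₂ log_ω P` (index-blind; dyadic table T4). -/
  ℓ : ℤ
  /-- `v₂ ⟨P, P⟩₂` — FINITE is P-Bert (tree `bertrand_pairingSq_self_ne_zero_two_of_j_eq_neg3375`). -/
  hP : ℤ
  /-- the (2)₂ constant: `v = c₁ + lam + ℓ` (out-of-range explicit reciprocity, row 71). -/
  c₁ : ℤ
  /-- the (3)₂ constant: `⟨c_ell,P⟩ = e″·𝓛'·log_ω P`, `d₃ = v₂ e″` (Rubin's height identity). -/
  d₃ : ℤ
  /-- the (5)₂ constant of PRGZ₂ ∘ CM-factorisation. -/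
  d₅ : ℤ
  /-- the twin's in-range interpolation digit: `vt = At + dt`. -/
  dt : ℤ
  /-- the Gross–Zagier digit: `2i = A + At + dG` (Manin, `c`, `u_K`, torsion). -/
  dG : ℤ
  /-- the ALG digit: `fp = B + hP + da` (Perrin-Riou/Schneider/Nekovář leading term). -/
  da : ℤ

namespace HModel

variable (m : HModel)

/-! ## §1 The laws (each a `Prop`; nothing asserted) -/

/-- `x = v₂ log_ω(y_K) = i + ℓ`. -/
def x : ℤ := m.i + m.ℓ
/-- `v₂ ⟨c_ell, y_K⟩₂ = hc + i`. -/
def hcy : ℤ := m.hc + m.i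
/-- `v₂ ⟨y_K, y_K⟩₂ = 2i + hP`. -/
def hyy : ℤ := 2 * m.i + m.hP

/-- Gross–Zagier in index form (in the crux's bundle): `2i = A + At + dG`. -/
def GZ : Prop := 2 * m.i = m.A + m.At + m.dG
/-- LOWER for `W` with slack `s`: `v₂ Ш_an(W) ≤ v₂ #Ш(W)[2^∞] + s`. The stub mod O_key(1). -/
def Lower (s : ℤ) : Prop := m.A ≤ m.B + s
/-- UPPER (GZK, child 27850) with slack `u`. -/
def Upper (u : ℤ) : Prop := m.B ≤ m.A + u
/-- The `x`-law in `K`-currency (HARDEST (a), R226): `2x + κ ≤ v₂(val_W · val_tw)`. -/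
def XLawK (κ : ℤ) : Prop := 2 * m.x + κ ≤ m.v + m.vt
/-- Twin interpolation (in range, weight 0): `vt = At + dt`. -/
def TwinVal : Prop := m.vt = m.At + m.dt
/-- (2)₂ with defect `δ`: `v = c₁ + lam + ℓ + δ` (`δ = 0` is the exact law of row 71). -/
def Recip2 (δ : ℤ) : Prop := m.v = m.c₁ + m.lam + m.ℓ + δ
/-- (2)₂ one-sided: `c₁ + lam + ℓ + e ≤ v`. -/
def Recip2lb (e : ℤ) : Prop := m.c₁ + m.lam + m.ℓ + e ≤ m.v
/-- Colinearity ∧ P-Bert: `λ = ⟨c_ell,P⟩/⟨P,P⟩`, i.e. `lam = hc − hP` (needs `⟨P,P⟩₂ ≠ 0`). -/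
def LamDef : Prop := m.lam = m.hc - m.hP
/-- (3)₂ with defect `δ`: `hc = L1 + ℓ + d₃ + δ` (Rubin's height identity; weight 0). -/
def Height3 (δ : ℤ) : Prop := m.hc = m.L1 + m.ℓ + m.d₃ + δ
/-- (3)₂ one-sided: `L1 + ℓ + e ≤ hc` («`𝓛'·log_ω P·2^e` divides `⟨c_ell,P⟩₂`»). -/
def Height3lb (e : ℤ) : Prop := m.L1 + m.ℓ + e ≤ m.hc
/-- (5)₂ = PRGZ₂ ∘ CM factorisation with defect `δ`: `L1 + vt = 2i + hP + d₅ + δ`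
(`𝓛'_p(W/K)(𝟙) = 𝓛'_cyc(ψ_W)·val_tw ≐ ⟨y_K,y_K⟩₂`). -/
def PRGZ (δ : ℤ) : Prop := m.L1 + m.vt = 2 * m.i + m.hP + m.d₅ + δ
/-- (5)₂ ONE-SIDED: `2i + hP + e ≤ L1 + vt` («`⟨y_K,y_K⟩₂·2^e` divides `𝓛'_cyc(ψ_W)·val_tw`»). Weight 2. -/
def PRGZlb (e : ℤ) : Prop := 2 * m.i + m.hP + e ≤ m.L1 + m.vt
/-- (5)₂ the OTHER side: `L1 + vt ≤ 2i + hP + e` («`𝓛'_cyc(ψ_W)·val_tw` divides `⟨y_K,y_K⟩₂·2^e`»).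
Never consumed by RT⁺ or road B⁻; UPPER-type (§4 `prgzub_iff_upper_of_twoSided`). -/
def PRGZub (e : ℤ) : Prop := m.L1 + m.vt ≤ 2 * m.i + m.hP + e
/-- THE MERGED CLAUSE (3)₂⁻ ⊕ (5)₂⁻ in intrinsic coordinates:
`v₂⟨y_K,y_K⟩₂ + v₂ log_ω y_K + e ≤ v₂⟨c_ell,y_K⟩₂ + v₂ val_tw`. Weight 2. -/
def Merged (e : ℤ) : Prop := m.hyy + m.x + e ≤ m.hcy + m.vt
/-- Road B⁻, MC⁻ on the cyclotomic line at the leading term: `𝓛 ∣ f` read `v₂ 𝓛' ≤ v₂ f'(0)`. Weight 0. -/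
def MCcyc : Prop := m.L1 ≤ m.fp
/-- Road B⁻, MC both containments at the leading term (for the consistency check only). -/
def MCeq : Prop := m.L1 = m.fp
/-- Road B⁻, ALG⁻ one-sided (§3 (iii)(b)): `v₂ f'(0) ≤ B + hP + da + e`. Weight 0. -/
def ALGub (e : ℤ) : Prop := m.fp ≤ m.B + m.hP + m.da + e
/-- Road B⁻, ALG exact. -/
def ALG : Prop := m.fp = m.B + m.hP + m.da
/-- Bilinear weight-1 half no. 1: `v₂⟨y_K,y_K⟩₂ + e ≤ v₂⟨c_ell,y_K⟩₂` (⟸ `c_ell ∈ 2^e ℤ₂·y_K`). -/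
def W1 (e : ℤ) : Prop := m.hyy + e ≤ m.hcy
/-- Bilinear weight-1 half no. 2 (the forced partner): `v₂ log_ω y_K + e ≤ v₂ val_tw`. -/
def W2 (e : ℤ) : Prop := m.x + e ≤ m.vt

/-! ## §2 Weakest sufficient form of RT⁺: only the TOTAL defect is consumed -/

/-- **RT⁺ consumes (2)₂, (3)₂, (5)₂ only through `δ₂ + δ₃ + δ₅`.** The twin (`At`, `dt`, `vt`) and the
height `hP` cancel; the `x`-law with constant `κ` holds iff `κ ≤ c₁ + d₃ + d₅ + Σδ`. -/
theorem xLawK_iff_totalDefect {δ₂ δ₃ δ₅ κ : ℤ} (h2 : m.Recip2 δ₂) (hl : m.LamDef)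
    (h3 : m.Height3 δ₃) (h5 : m.PRGZ δ₅) :
    m.XLawK κ ↔ κ ≤ m.c₁ + m.d₃ + m.d₅ + δ₂ + δ₃ + δ₅ := by
  unfold XLawK x; unfold Recip2 at h2; unfold LamDef at hl; unfold Height3 at h3; unfold PRGZ at h5
  constructor <;> intro h <;> omega

/-- The exact chain: RT⁺ with all defects `0` outputs the member law with constant `c₁ + d₃ + d₅`. -/
theorem xLawK_of_RT_exact (h2 : m.Recip2 0) (hl : m.LamDef) (h3 : m.Height3 0) (h5 : m.PRGZ 0) :
    m.XLawK (m.c₁ + m.d₃ + m.d₅) :=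
  (m.xLawK_iff_totalDefect h2 hl h3 h5).2 (by omega)

/-- One-sided suffices: the three LOWER halves (2)₂⁻, (3)₂⁻, (5)₂⁻ give the `x`-law with constant
`c₁ + e₂ + e₃ + e₅` — exactness of none of the three laws is consumed (B1 made quantitative). -/
theorem xLawK_of_lb {e₂ e₃ e₅ : ℤ} (h2 : m.Recip2lb e₂) (hl : m.LamDef) (h3 : m.Height3lb e₃)
    (h5 : m.PRGZlb e₅) : m.XLawK (m.c₁ + e₂ + e₃ + e₅) := by
  unfold XLawK x; unfold Recip2lb at h2; unfold LamDef at hl; unfold Height3lb at h3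
  unfold PRGZlb at h5; omega

/-! ## §3 The merged clause is the weakest sufficient AND necessary GZ-sensitive input of RT⁺ -/

/-- (3)₂⁻ ⊕ (5)₂⁻ ⟹ `Merged`. -/
theorem merged_of_lb {e₃ e₅ : ℤ} (h3 : m.Height3lb e₃) (h5 : m.PRGZlb e₅) : m.Merged (e₃ + e₅) := by
  unfold Merged hyy hcy x; unfold Height3lb at h3; unfold PRGZlb at h5; omega

/-- `Merged` ⟹ the `x`-law, given (2)₂⁻ and colinearity/P-Bert. -/
theorem xLawK_of_merged {e₂ e : ℤ} (h2 : m.Recip2lb e₂) (hl : m.LamDef) (hM : m.Merged e) :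
    m.XLawK (m.c₁ + e₂ + e) := by
  unfold XLawK x; unfold Merged hyy hcy x at hM; unfold Recip2lb at h2; unfold LamDef at hl; omega

/-- **Sharpness.** Given (2)₂ with any defect `δ₂` and colinearity, `Merged e` is EQUIVALENT to the
`x`-law with constant `c₁ + δ₂ + e`: the merged clause is exactly RT⁺'s residual (≡ the stub mod
O_key(1), R226), nothing weaker will do and nothing stronger is used. -/
theorem merged_iff_xLawK {δ₂ e : ℤ} (h2 : m.Recip2 δ₂) (hl : m.LamDef) :
    m.Merged e ↔ m.XLawK (m.c₁ + δ₂ + e) := by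
  unfold Merged XLawK hyy hcy x; unfold Recip2 at h2; unfold LamDef at hl
  constructor <;> intro h <;> omega

/-! ## §4 Road B⁻ consumes the SAME clause -/

/-- Modulo the weight-0 identity (3)₂ (defect `δ₃`), road B⁻'s one-sided PRGZ₂ IS the merged clause. -/
theorem prgzlb_iff_merged {δ₃ e : ℤ} (h3 : m.Height3 δ₃) :
    m.PRGZlb e ↔ m.Merged (e + m.d₃ + δ₃) := by
  unfold PRGZlb Merged hyy hcy x; unfold Height3 at h3; constructor <;> intro h <;> omega

/-- **Road B⁻ (FALLBACK 1″), one-sided throughout:** PRGZ₂⁻ ∧ MC⁻ ∧ ALG⁻ ∧ GZ ∧ twin interpolation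
⟹ LOWER with slack `da + dt − dG + e_a − e₅`. `hP` cancels (P-Bert = finiteness only). -/
theorem lower_of_roadB_oneSided {e₅ ea : ℤ} (h5 : m.PRGZlb e₅) (hmc : m.MCcyc) (ha : m.ALGub ea)
    (hG : m.GZ) (ht : m.TwinVal) : m.Lower (m.da + m.dt - m.dG + ea - e₅) := by
  unfold Lower; unfold PRGZlb at h5; unfold MCcyc at hmc; unfold ALGub at ha; unfold GZ at hG
  unfold TwinVal at ht; omega

/-- **R226-consistency.** With MC BOTH ways and exact ALG (index-blind, two-sided), the one-sided
PRGZ₂ clause is EQUIVALENT to LOWER: it is weight 2 ≡ the stub mod O_key(1) — road B⁻'s whole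
GZ-sensitive content is this one inequality (and it is RT⁺'s, §4 first lemma). -/
theorem prgzlb_iff_lower_of_twoSided {e : ℤ} (hmc : m.MCeq) (ha : m.ALG) (hG : m.GZ)
    (ht : m.TwinVal) : m.PRGZlb e ↔ m.Lower (m.da + m.dt - m.dG - e) := by
  unfold PRGZlb Lower; unfold MCeq at hmc; unfold ALG at ha; unfold GZ at hG; unfold TwinVal at ht
  constructor <;> intro h <;> omega

/-- … and the other half of the exact law (5)₂ is UPPER-type: modulo the same two-sided index-blind
inputs it is EQUIVALENT to UPPER (GZK's proved direction, child 27850). So the exact PRGZ₂ of row 61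
splits as (LOWER-type half ≡ the stub) ⊕ (UPPER-type half ≡ the known side); only `PRGZlb` is wanted. -/
theorem prgzub_iff_upper_of_twoSided {e : ℤ} (hmc : m.MCeq) (ha : m.ALG) (hG : m.GZ)
    (ht : m.TwinVal) : m.PRGZub e ↔ m.Upper (e + m.dG - m.da - m.dt) := by
  unfold PRGZub Upper; unfold MCeq at hmc; unfold ALG at ha; unfold GZ at hG; unfold TwinVal at ht
  constructor <;> intro h <;> omega

/-- The exact law is the conjunction of its two halves (bookkeeping). -/
theorem prgz_iff_lb_ub {δ : ℤ} : m.PRGZ δ ↔ m.PRGZlb (m.d₅ + δ) ∧ m.PRGZub (m.d₅ + δ) := by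
  unfold PRGZ PRGZlb PRGZub; constructor <;> intro h <;> omega

/-! ## §4b The `x`-law defect IS the Ш-defect (strongest provable form = the reverse `x`-law) -/

/-- **One integer.** Modulo the weight-0 identities, taken two-sided ((2)₂, (3)₂, colinearity, MC⁼,
ALG, twin interpolation) and Gross–Zagier, the defect of the `x`-law and the Ш-defect coincide:
`v + vt − 2x = (c₁ + d₃ + da + dt − dG) + (B − A)`. Hence LOWER-type statements bound it below (the
stub), UPPER-type statements bound it above (the proved direction) — R226's «(a) ≡ stub mod O_key(1)»
re-derived through the HEIGHT coordinates rather than k3-g45's Selmer pins. -/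
theorem xDefect_eq_shaDefect (h2 : m.Recip2 0) (hl : m.LamDef) (h3 : m.Height3 0) (hmc : m.MCeq)
    (ha : m.ALG) (hG : m.GZ) (ht : m.TwinVal) :
    m.v + m.vt - 2 * m.x = (m.c₁ + m.d₃ + m.da + m.dt - m.dG) + (m.B - m.A) := by
  unfold x; unfold Recip2 at h2; unfold LamDef at hl; unfold Height3 at h3; unfold MCeq at hmc
  unfold ALG at ha; unfold GZ at hG; unfold TwinVal at ht; omega

/-- LOWER ≡ the `x`-law (two-sided weight-0 inputs). -/
theorem xLawK_iff_lower_twoSided {κ : ℤ} (h2 : m.Recip2 0) (hl : m.LamDef) (h3 : m.Height3 0)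
    (hmc : m.MCeq) (ha : m.ALG) (hG : m.GZ) (ht : m.TwinVal) :
    m.XLawK κ ↔ m.Lower (m.c₁ + m.d₃ + m.da + m.dt - m.dG - κ) := by
  have h := m.xDefect_eq_shaDefect h2 hl h3 hmc ha hG ht
  unfold XLawK Lower; constructor <;> intro h' <;> omega

/-- **Strongest provable form.** UPPER (the known direction) ≡ the REVERSE `x`-law
`v + vt ≤ 2x + (c₁ + d₃ + da + dt − dG) + u`: an upper bound on `v₂(val_W·val_tw)` by `2·v₂ log_ω y_K`
is what the proved side gives; the stub is exactly the other inequality. -/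
theorem xLawKrev_iff_upper_twoSided {u : ℤ} (h2 : m.Recip2 0) (hl : m.LamDef) (h3 : m.Height3 0)
    (hmc : m.MCeq) (ha : m.ALG) (hG : m.GZ) (ht : m.TwinVal) :
    m.v + m.vt ≤ 2 * m.x + (m.c₁ + m.d₃ + m.da + m.dt - m.dG) + u ↔ m.Upper u := by
  have h := m.xDefect_eq_shaDefect h2 hl h3 hmc ha hG ht
  unfold Upper; constructor <;> intro h' <;> omega

/-! ## §5 The bilinear weight-1 ⊕ weight-1 pair: implies the clause, but is NOT uniform (no-go) -/

/-- `W1` is the Euler-system divisibility of record: given colinearity, `W1 e` says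
`i + e ≤ v₂ λ`, i.e. `c_ell ∈ 2^e ℤ₂·y_K` — v7.9's «ES divisibility relative to κ(y₀)» withdrawn by
row 131 (C1) as weight 1 without partner; `HeegnerShiftK3G45.Weight1 κ₁` is `W1 (ℓ + κ₁)`. -/
theorem W1_iff_esDivisibility {e : ℤ} (hl : m.LamDef) : m.W1 e ↔ m.i + e ≤ m.lam := by
  unfold W1 hyy hcy; unfold LamDef at hl; constructor <;> intro h <;> omega

/-- **The partner is forced.** If `W1` holds with EXACT slack `e₁` (`⟨c_ell,y_K⟩₂ ≐ 2^{e₁}⟨y_K,y_K⟩₂`),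
the merged clause with constant `e` is equivalent to `W2 (e − e₁)`: the complementary weight-1 partner
of the ES-divisibility half is «`log_ω(y_K)·2^{e−e₁}` divides the twin's in-range value», nothing else. -/
theorem partner_forced {e₁ e : ℤ} (hW1 : m.hcy = m.hyy + e₁) : m.Merged e ↔ m.W2 (e - e₁) := by
  unfold Merged W2; constructor <;> intro h <;> omega

/-- The pair does imply the merged clause. -/
theorem merged_of_W1_W2 {e₁ e₂ : ℤ} (h1 : m.W1 e₁) (h2 : m.W2 e₂) : m.Merged (e₁ + e₂) := by
  unfold Merged; unfold W1 at h1; unfold W2 at h2; omega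

/-- **Window.** Under the exact identities, `W1 e₁` holds iff the twin is NOT too large
(`At ≤ A + 2ℓ + dG + 2(d₃ + d₅ − dt − e₁)`), `W2 e₂` iff the twin is NOT too small
(`A + 2ℓ + dG − 2dt + 2e₂ ≤ At`): the pair certifies the `x`-law exactly on twin-balanced members. -/
theorem bilinearPair_iff_window {e₁ e₂ : ℤ} (h3 : m.Height3 0) (h5 : m.PRGZ 0) (hG : m.GZ)
    (ht : m.TwinVal) :
    (m.W1 e₁ ↔ m.At ≤ m.A + 2 * m.ℓ + m.dG + 2 * (m.d₃ + m.d₅ - m.dt - e₁)) ∧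
      (m.W2 e₂ ↔ m.A + 2 * m.ℓ + m.dG - 2 * m.dt + 2 * e₂ ≤ m.At) := by
  unfold W1 W2 hyy hcy x; unfold Height3 at h3; unfold PRGZ at h5; unfold GZ at hG
  unfold TwinVal at ht; constructor <;> (constructor <;> intro h <;> omega)

/-- A member is CONSISTENT if it satisfies every identity of the plan exactly, Gross–Zagier, the twin
interpolation, UPPER, LOWER and the `x`-law (so: a member on which BSD₂ and every law of record hold). -/
structure Consistent (m : HModel) : Prop where
  gz : m.GZ
  twin : m.TwinVal
  recip : m.Recip2 0
  lamDef : m.LamDef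
  height : m.Height3 0
  prgz : m.PRGZ 0
  mc : m.MCcyc
  alg : m.ALG
  upper : m.Upper 0
  lower : m.Lower 0
  xlaw : m.XLawK (m.c₁ + m.d₃ + m.d₅)

/-- Twin-dominant witness: `A = 0`, `At = 2k`, `i = k`, all digits `0`. -/
def twinDominant (k : ℤ) : HModel where
  i := k; B := 0; A := 0; At := 2 * k; v := 0; vt := 2 * k; lam := 0; hc := 0; L1 := 0; fp := 0
  ℓ := 0; hP := 0; c₁ := 0; d₃ := 0; d₅ := 0; dt := 0; dG := 0; da := 0

/-- `W`-dominant witness: `A = 2k`, `At = 0`, `i = k`, `B = 2k`, all digits `0`. -/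
def selfDominant (k : ℤ) : HModel where
  i := k; B := 2 * k; A := 2 * k; At := 0; v := 2 * k; vt := 0; lam := 2 * k; hc := 2 * k
  L1 := 2 * k; fp := 2 * k; ℓ := 0; hP := 0; c₁ := 0; d₃ := 0; d₅ := 0; dt := 0; dG := 0; da := 0

/-- Consistent for EVERY `k` (no sign condition is needed). -/
theorem twinDominant_consistent (k : ℤ) : Consistent (twinDominant k) := by
  constructor <;> simp [twinDominant, GZ, TwinVal, Recip2, LamDef, Height3, PRGZ, MCcyc, ALG, Upper,
    Lower, XLawK, x]

theorem selfDominant_consistent (k : ℤ) : Consistent (selfDominant k) := by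
  constructor <;> simp [selfDominant, GZ, TwinVal, Recip2, LamDef, Height3, PRGZ, MCcyc, ALG, Upper,
    Lower, XLawK, x]

theorem twinDominant_not_W1 (k e : ℤ) (hk : -e < k) : ¬ (twinDominant k).W1 e := by
  simp [W1, hyy, hcy, twinDominant]; omega

theorem selfDominant_not_W2 (k e : ℤ) (hk : -e < k) : ¬ (selfDominant k).W2 e := by
  simp [W2, x, selfDominant]; omega

/-- **NO-GO for the bilinear weight-1 pair (answers B80's parked «name the partner»).** For every
constant `e` there is a consistent member (all laws exact, GZ, UPPER, LOWER, the `x`-law all TRUE) on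
which `W1 e` fails, and one on which `W2 e` fails: neither half is a consequence of the truth of
everything the plan wants, so the pair is not a uniform route to (a). -/
theorem no_uniform_bilinear_pair (e : ℤ) :
    (∃ m : HModel, Consistent m ∧ ¬ m.W1 e) ∧ (∃ m : HModel, Consistent m ∧ ¬ m.W2 e) := by
  refine ⟨⟨twinDominant (|e| + 1), twinDominant_consistent _,
      twinDominant_not_W1 _ _ (by cases abs_cases e <;> omega)⟩,
    ⟨selfDominant (|e| + 1), selfDominant_consistent _,
      selfDominant_not_W2 _ _ (by cases abs_cases e <;> omega)⟩⟩

/-! ## §5b The only uniform weight-1 realisation is a self-partnered SQUARE ROOT (engine currency) -/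

/-- If an auxiliary quantity `w` satisfies `v + vt + r = 2w` (`r` index-blind; the engine's
`Ka·Kb = w·S²`, T3.7-LT, `w ↔ v₂ S`), the `x`-law is the weight-1 law `x + e ≤ w` used twice. -/
theorem xLawK_iff_sqrt {w r κ : ℤ} (hS : m.v + m.vt + r = 2 * w) :
    m.XLawK κ ↔ 2 * m.x + κ + r ≤ 2 * w := by
  unfold XLawK; constructor <;> intro h <;> omega

theorem xLawK_of_sqrtLaw {w r e : ℤ} (hS : m.v + m.vt + r = 2 * w) (hw : m.x + e ≤ w) :
    m.XLawK (2 * e - r) := by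
  unfold XLawK; omega

/-! ## §6 Weights under the Heegner shift (R226's test made executable on the height coordinates) -/

/-- The Heegner shift: `y_K ↦ 2^t·y_K` with every index-blind quantity, the ES class, `P`, the twin and
all digits FIXED (`A ↦ A + 2t` keeps Gross–Zagier). -/
def shift (t : ℤ) : HModel := { m with i := m.i + t, A := m.A + 2 * t }

@[simp] theorem shift_i (t : ℤ) : (m.shift t).i = m.i + t := rfl
@[simp] theorem shift_A (t : ℤ) : (m.shift t).A = m.A + 2 * t := rfl

theorem gz_shift (t : ℤ) : (m.shift t).GZ ↔ m.GZ := by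
  unfold GZ shift; constructor <;> intro h <;> simp only at * <;> omega

/-- weight 0 (index-blind): the identities and road-B⁻'s MC/ALG clauses are shift-INVARIANT. -/
theorem weight_zero (t δ e : ℤ) :
    ((m.shift t).Recip2 δ ↔ m.Recip2 δ) ∧ ((m.shift t).LamDef ↔ m.LamDef) ∧
    ((m.shift t).Height3 δ ↔ m.Height3 δ) ∧ ((m.shift t).TwinVal ↔ m.TwinVal) ∧
    ((m.shift t).MCcyc ↔ m.MCcyc) ∧ ((m.shift t).ALGub e ↔ m.ALGub e) :=
  ⟨Iff.rfl, Iff.rfl, Iff.rfl, Iff.rfl, Iff.rfl, Iff.rfl⟩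

/-- weight 2: `Merged`, `PRGZlb`, the `x`-law and LOWER each cost `2t` under the shift. -/
theorem weight_two (t e κ s : ℤ) :
    ((m.shift t).Merged e ↔ m.Merged (e + 2 * t)) ∧ ((m.shift t).PRGZlb e ↔ m.PRGZlb (e + 2 * t)) ∧
    ((m.shift t).XLawK κ ↔ m.XLawK (κ + 2 * t)) ∧ ((m.shift t).Lower s ↔ m.Lower (s - 2 * t)) := by
  refine ⟨?_, ?_, ?_, ?_⟩
  · unfold Merged hyy hcy x shift; constructor <;> intro h <;> simp only at * <;> omega
  · unfold PRGZlb shift; constructor <;> intro h <;> simp only at * <;> omega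
  · unfold XLawK x shift; constructor <;> intro h <;> simp only at * <;> omega
  · unfold Lower shift; constructor <;> intro h <;> simp only at * <;> omega

/-- UPPER-type: the shift RELAXES `PRGZub e` to `PRGZub (e + 2t)` (its slack `e` sits on the index
side), so it is upward-closed like UPPER — R226 (C1) — whereas in `weight_two` the same `+ 2t` TIGHTENS
`Merged`/`PRGZlb`/`XLawK` (their constant sits against the index). -/
theorem prgzub_shift (t e : ℤ) : (m.shift t).PRGZub e ↔ m.PRGZub (e + 2 * t) := by
  unfold PRGZub shift; constructor <;> intro h <;> simp only at * <;> omega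

/-- weight 1: each bilinear half costs `t` — they ARE half-bridges (GZ-sensitive), just not uniform (§5). -/
theorem weight_one (t e : ℤ) :
    ((m.shift t).W1 e ↔ m.W1 (e + t)) ∧ ((m.shift t).W2 e ↔ m.W2 (e + t)) := by
  refine ⟨?_, ?_⟩
  · unfold W1 hyy hcy shift; constructor <;> intro h <;> simp only at * <;> omega
  · unfold W2 x shift; constructor <;> intro h <;> simp only at * <;> omega

/-- UPPER is upward-closed under the shift (index-blind as an OBSTRUCTION, R226 (C1)). -/
theorem upper_shift (t u : ℤ) (ht : 0 ≤ t) (h : m.Upper u) : (m.shift t).Upper u := by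
  unfold Upper at *; simp only [shift] at *; omega

end HModel

end Summit.BirchSwinnertonDyer.BirchSwinnertonDyer.Cruxes.SplitBadTwoLowerHalfOfFacts.WeakStrongK1G45
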